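import Mathlib
import HarnessLib
import Summits.CriticalPhenomena.Ising3DConformalLimit.Theses.ModularBoosts
import Summits.CriticalPhenomena.Ising3DConformalLimit.Theses.HyperoctahedralRP
import Summits.CriticalPhenomena.Ising3DConformalLimit.Theorems.HyperoctahedralRPHRP2Rigidity
import Summits.CriticalPhenomena.Ising3DConformalLimit.Theorems.HyperoctahedralRPTwoPointKernelOfLimitClauses
import Summits.CriticalPhenomena.Ising3DConformalLimit.Theorems.HyperoctahedralRPTwoPointLimitIsotropicHolds
import Literature.Probability.LatticeModels.CriticalWickDichotomy

/-!
# `LimitRotationInvariance` (route ModularBoosts, milestone item stmt-CriticalPhenomena-5434):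
# reductions, and the unconditional cases `n ≤ 2` and `n` odd

The milestone `ModularBoosts.LimitRotationInvariance` — every normalised, non-degenerate,
translation-invariant, scale-covariant pointwise scaling limit `S` of the critical nearest-neighbour
Ising correlators on `ℤ³` is `O(3)`-invariant (all `n`) — is rotation invariance of the critical
`ℤ³` Ising scaling limit, listed as open in H. Duminil-Copin, ICM 2022, §8.1 (a postulate on `ℤ³`;
a theorem only in 2D). This file records what the tree proves about it:

* `limitRotationInvariance_iff_hyperoctahedral`: it is EQUIVALENT to the crux
  `HyperoctahedralRP.LimitRotationInvariant` (item stmt-1980, `= HRP2Rigidity → …`), because the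
  nine-mirror rigidity `HRP2Rigidity` is a tree theorem (`HRP2Rigidity_of`);
* `limitRotationInvariance_of_lightCone_of_modular`: inside route ModularBoosts it hinges on the two
  cruxes (L) `IsingLimitLightCone` and (M) `ModularBoostIsotropy` ALONE — the support items (V)
  `EllipsoidToSphere` (pure linear algebra, `rotationInvariant_of_ellipsoid_swap`) and (B₃)
  `IsingLimitAxisPermutation` (`limit_axisPerm`, lattice symmetry passes to every limit) are
  discharged here, and `Δ > 0` comes from the tree's window `1/2 ≤ Δ ≤ 1` (`window`);
  `limitRotationInvariance_of_cruxes` is the same with the route items (V), (B₃) as hypotheses;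
* `rotation_invariant_of_le_two`, `rotation_invariant_of_odd`: UNCONDITIONALLY, every such limit
  is `O(3)`-invariant at the levels `n ≤ 2` (`n = 2` is the tree's two-point isotropy
  `kernel_rotation_invariant`, i.e. `HRP2Rigidity_of` composed with `twoPointKernelOfLimit_proof`;
  `n ≤ 1` is translation invariance) and at every odd level (odd critical correlators vanish,
  `m*(β_c) = 0`, `HasPointwiseScalingLimit.eq_zero_of_odd`); so what is open is exactly the even
  levels `n ≥ 4` on non-coincident configurations (`limitRotationInvariance_iff_even_four_le`).

References: H. Duminil-Copin, *100 years of the (critical) Ising model on the hypercubic lattice*,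
Proc. ICM 2022, §8.1; M. Aizenman, H. Duminil-Copin, V. Sidoravicius, Comm. Math. Phys. 334
(2015), Thm. 1.2; P. Di Francesco, P. Mathieu, D. Sénéchal, *Conformal Field Theory* (1997),
§4.3.1; S. Friedli, Y. Velenik (CUP 2017), Exercise 3.14. No definitions are introduced.
-/

noncomputable section

namespace Summit.CriticalPhenomena.Ising3DConformalLimit.ModularBoostsRotation

open Literature.Probability.LatticeModels
open Summit.CriticalPhenomena.Ising3DConformalLimit.Theses
open Summit.CriticalPhenomena.Ising3DConformalLimit.Theses.ModularBoosts
open Summit.CriticalPhenomena.Ising3DConformalLimit.MoebiusLimitExistsNegative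
open Summit.CriticalPhenomena.Ising3DConformalLimit.HyperoctahedralRPTwoPoint

variable {ρ : ℝ → ℝ} {Δ : ℝ} {S : CorrFamily 3}

/-! ### The milestone is the crux `HyperoctahedralRP.LimitRotationInvariant` -/

/-- **`ModularBoosts.LimitRotationInvariance ↔ HyperoctahedralRP.LimitRotationInvariant`.** The
HyperoctahedralRP crux (item stmt-1980) is the same statement guarded by the hypothesis
`HRP2Rigidity`, which is a tree theorem (`HRP2Rigidity_of`, nine-mirror reflection-positivity
rigidity of homogeneous kernels); so the two items are logically the same open statement — rotation
invariance of the critical `ℤ³` Ising scaling limit at all levels `n`.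
[cite: DuminilCopinICM2022, §8.1] -/
theorem limitRotationInvariance_iff_hyperoctahedral :
    LimitRotationInvariance ↔ HyperoctahedralRP.LimitRotationInvariant :=
  ⟨fun h _ => h,
    fun h => h Summit.CriticalPhenomena.Ising3DConformalLimit.Cruxes.HRP2Rigidity.XRayMellin.HRP2Rigidity_of⟩

/-! ### (B₃): axis permutations pass to every normalised limit -/

/-- **(B₃) for free.** Every pointwise scaling limit of `criticalCorr 3` which vanishes off the
non-coincident configurations is invariant under the coordinate permutations of `ℝ³`, at every
level `n` and every configuration (on `NonCoincident` this is the tree's `limit_coordPerm`; off it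
both sides vanish). This is the content of the route item `IsingLimitAxisPermutation`.
[cite: FriedliVelenik2017, Exercise 3.14, p. 115] -/
theorem limit_axisPerm (hlim : HasPointwiseScalingLimit (criticalCorr 3) ρ S)
    (hnorm : ∀ n z, z ∉ NonCoincident 3 n → S n z = 0) (π : Equiv.Perm (Fin 3)) (n : ℕ)
    (x : Fin n → EuclideanSpace ℝ (Fin 3)) :
    S n (fun i => LinearIsometryEquiv.piLpCongrLeft 2 ℝ ℝ π (x i)) = S n x := by
  by_cases hx : x ∈ NonCoincident 3 n
  · exact limit_coordPerm hlim π hx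
  · rw [hnorm n x hx, hnorm n _ (mt (map_mem_nonCoincident_iff _ x).1 hx)]

/-! ### (V): ellipsoidal isotropy + the axis swap + scale covariance + positivity ⇒ `O(3)` -/

/-- The linear map `A_c (z₀, z₁, z₂) = (-c z₂, z₁, z₀ / c)` of `ℝ³` exists (for `c ≠ 0` it is
`D⁻¹ R D` with `D = diag(1,1,c)` and `R` the quarter turn of the `(0,2)`-plane, hence preserves the
quadratic form `z₀² + z₁² + c² z₂²`). [folklore] -/
theorem exists_quarterTurnConj (c : ℝ) :
    ∃ A : EuclideanSpace ℝ (Fin 3) →ₗ[ℝ] EuclideanSpace ℝ (Fin 3), ∀ z : EuclideanSpace ℝ (Fin 3),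
      A z 0 = -c * z 2 ∧ A z 1 = z 1 ∧ A z 2 = c⁻¹ * z 0 := by
  refine ⟨Matrix.toEuclideanLin !![0, 0, -c; 0, 1, 0; c⁻¹, 0, 0], fun z => ⟨?_, ?_, ?_⟩⟩ <;>
    simp [Matrix.toEuclideanLin, Matrix.toLpLin_apply, dotProduct, Fin.sum_univ_three]

/-- Such an `A_c` preserves `z₀² + z₁² + c² z₂²` (`c ≠ 0`). [folklore] -/
theorem quarterTurnConj_preserves {c : ℝ} (hc : c ≠ 0)
    {A : EuclideanSpace ℝ (Fin 3) →ₗ[ℝ] EuclideanSpace ℝ (Fin 3)}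
    (hA : ∀ z : EuclideanSpace ℝ (Fin 3), A z 0 = -c * z 2 ∧ A z 1 = z 1 ∧ A z 2 = c⁻¹ * z 0)
    (z : EuclideanSpace ℝ (Fin 3)) :
    (A z) 0 ^ 2 + (A z) 1 ^ 2 + c ^ 2 * (A z) 2 ^ 2 = z 0 ^ 2 + z 1 ^ 2 + c ^ 2 * z 2 ^ 2 := by
  obtain ⟨h0, h1, h2⟩ := hA z
  rw [h0, h1, h2]
  field_simp
  ring

/-- Coordinates of the axis swap `x₀ ↔ x₂`. [folklore] -/
theorem swap02_apply (z : EuclideanSpace ℝ (Fin 3)) (j : Fin 3) :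
    LinearIsometryEquiv.piLpCongrLeft 2 ℝ ℝ (Equiv.swap (0 : Fin 3) 2) z j =
      z (Equiv.swap (0 : Fin 3) 2 j) := by
  rw [coordPerm_apply, Equiv.symm_swap]

/-- The word `A ∘ P ∘ A ∘ P` (`A = A_c`, `P` the swap `x₀ ↔ x₂`) dilates the first axis by `c²`:
it maps `e₀` to `c² e₀`. [folklore] -/
theorem word_single_zero {c : ℝ} {A : EuclideanSpace ℝ (Fin 3) →ₗ[ℝ] EuclideanSpace ℝ (Fin 3)}
    (hA : ∀ z : EuclideanSpace ℝ (Fin 3), A z 0 = -c * z 2 ∧ A z 1 = z 1 ∧ A z 2 = c⁻¹ * z 0) :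
    A (LinearIsometryEquiv.piLpCongrLeft 2 ℝ ℝ (Equiv.swap (0 : Fin 3) 2)
      (A (LinearIsometryEquiv.piLpCongrLeft 2 ℝ ℝ (Equiv.swap (0 : Fin 3) 2)
        (EuclideanSpace.single 0 (1:ℝ))))) = (c ^ 2) • EuclideanSpace.single 0 (1:ℝ) := by
  set P := LinearIsometryEquiv.piLpCongrLeft 2 ℝ ℝ (Equiv.swap (0 : Fin 3) 2) with hP
  have hPe : P (EuclideanSpace.single 0 (1:ℝ)) = EuclideanSpace.single 2 (1:ℝ) := by
    ext j
    rw [hP, swap02_apply]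
    fin_cases j <;> simp [Equiv.swap_apply_def]
  have hAe : A (EuclideanSpace.single 2 (1:ℝ)) = (-c) • EuclideanSpace.single 0 (1:ℝ) := by
    ext j
    obtain ⟨h0, h1, h2⟩ := hA (EuclideanSpace.single 2 (1:ℝ))
    fin_cases j
    · simpa using h0
    · simpa using h1
    · simpa using h2
  rw [hPe, hAe, map_smul, hPe, map_smul, hAe, smul_smul]
  congr 1
  ring

/-- **(V), pure linear algebra.** If `S : CorrFamily 3` has positive two-point function on
non-coincident pairs, is scale covariant with `Δ > 0`, is invariant under the axis swap `x₀ ↔ x₂`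
and under every linear map preserving `Q_c = x₀² + x₁² + c² x₂²` (`c > 0`), then `S` is
`O(3)`-invariant. Proof: with `A = A_c` of `exists_quarterTurnConj` (it preserves `Q_c`) and the
swap `P`, the
word `A P A P` fixes `0` and sends `e₀` to `c² e₀`, so `S 2 (0, c² e₀) = S 2 (0, e₀)`; scale
covariance gives `S 2 (0, c² e₀) = (c²)^(-2Δ) S 2 (0, e₀)` with `S 2 (0, e₀) > 0`, whence
`(c²)^(-2Δ) = 1`, `c = 1`, and the maps preserving `Q_1 = ‖·‖²` include every linear isometry.
This is the content of the route item `EllipsoidToSphere`.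
[cite: FrancescoMathieuSenechal1997, §4.3.1] -/
theorem rotationInvariant_of_ellipsoid_swap {Δ c : ℝ} {S : CorrFamily 3} (hΔ : 0 < Δ)
    (hc : 0 < c) (hnd : IsNondegenerateTwoPoint S) (hsc : IsScaleCovariant Δ S)
    (hswap : ∀ (n : ℕ) (x : Fin n → EuclideanSpace ℝ (Fin 3)),
      S n (fun i => LinearIsometryEquiv.piLpCongrLeft 2 ℝ ℝ (Equiv.swap (0 : Fin 3) 2) (x i)) =
        S n x)
    (hiso : ∀ (n : ℕ) (A : EuclideanSpace ℝ (Fin 3) →ₗ[ℝ] EuclideanSpace ℝ (Fin 3)),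
      (∀ z : EuclideanSpace ℝ (Fin 3), (A z) 0 ^ 2 + (A z) 1 ^ 2 + c ^ 2 * (A z) 2 ^ 2 =
        z 0 ^ 2 + z 1 ^ 2 + c ^ 2 * z 2 ^ 2) →
      ∀ x : Fin n → EuclideanSpace ℝ (Fin 3), S n (fun i => A (x i)) = S n x) :
    IsRotationInvariant S := by
  set P := LinearIsometryEquiv.piLpCongrLeft 2 ℝ ℝ (Equiv.swap (0 : Fin 3) 2) with hP
  obtain ⟨A, hA⟩ := exists_quarterTurnConj c
  set e₀ : EuclideanSpace ℝ (Fin 3) := EuclideanSpace.single 0 (1:ℝ) with he₀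
  have hApres : ∀ z : EuclideanSpace ℝ (Fin 3),
      (A z) 0 ^ 2 + (A z) 1 ^ 2 + c ^ 2 * (A z) 2 ^ 2 = z 0 ^ 2 + z 1 ^ 2 + c ^ 2 * z 2 ^ 2 :=
    fun z => quarterTurnConj_preserves hc.ne' hA z
  -- Step 1: `S 2 (0, c² e₀) = S 2 (0, e₀)` from the word `A P A P`
  have he₀ne : e₀ ≠ 0 := by
    intro h
    have := congrArg (fun v : EuclideanSpace ℝ (Fin 3) => v 0) h
    simp [he₀] at this
  set x : Fin 2 → EuclideanSpace ℝ (Fin 3) := ![0, e₀] with hx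
  set y₁ : Fin 2 → EuclideanSpace ℝ (Fin 3) := fun i => P (x i) with hy₁
  set y₂ : Fin 2 → EuclideanSpace ℝ (Fin 3) := fun i => A (y₁ i) with hy₂
  set y₃ : Fin 2 → EuclideanSpace ℝ (Fin 3) := fun i => P (y₂ i) with hy₃
  have hword : (fun i => A (y₃ i)) = ![0, (c ^ 2) • e₀] := by
    funext i
    fin_cases i
    · simp [hy₃, hy₂, hy₁, hx]
    · simp only [hy₃, hy₂, hy₁, hx, Fin.mk_one, Matrix.cons_val_one, Matrix.cons_val_fin_one]
      exact word_single_zero hA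
  have key : S 2 ![0, (c ^ 2) • e₀] = S 2 ![0, e₀] := by
    calc S 2 ![0, (c ^ 2) • e₀] = S 2 (fun i => A (y₃ i)) := by rw [hword]
      _ = S 2 y₃ := hiso 2 A hApres y₃
      _ = S 2 y₂ := hswap 2 y₂
      _ = S 2 y₁ := hiso 2 A hApres y₁
      _ = S 2 x := hswap 2 x
  -- Step 2: scale covariance and positivity force `c = 1`
  have hc2 : 0 < c ^ 2 := by positivity
  have hhom := kernel_homogeneous hsc (c ^ 2) hc2 e₀
  have hpos := kernel_pos hnd e₀ he₀ne
  rw [key] at hhom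
  have hone : (c ^ 2) ^ (-(2 * Δ)) = 1 := by
    have h := hhom.symm
    -- `r * K = K` with `K > 0`
    have : (c ^ 2) ^ (-(2 * Δ)) * S 2 ![0, e₀] = 1 * S 2 ![0, e₀] := by rw [one_mul]; exact h
    exact mul_right_cancel₀ hpos.ne' this
  have hc1 : c = 1 := by
    have hsq : c ^ 2 = 1 := by
      have hinj := Real.rpow_left_injOn (x := -(2 * Δ)) (by linarith)
      exact hinj (show (0:ℝ) ≤ c ^ 2 from hc2.le) (show (0:ℝ) ≤ 1 from zero_le_one)
        (hone.trans (Real.one_rpow _).symm)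
    exact (pow_left_inj₀ hc.le zero_le_one two_ne_zero).1 (by rw [hsq, one_pow])
  -- Step 3: with `c = 1`, every linear isometry preserves `Q_1 = ‖·‖²`
  subst hc1
  intro n R z
  have hnormsq : ∀ w : EuclideanSpace ℝ (Fin 3), w 0 ^ 2 + w 1 ^ 2 + w 2 ^ 2 = ‖w‖ ^ 2 :=
    fun w => by rw [EuclideanSpace.real_norm_sq_eq, Fin.sum_univ_three]
  have hR : ∀ w : EuclideanSpace ℝ (Fin 3),
      (R.toLinearEquiv.toLinearMap w) 0 ^ 2 + (R.toLinearEquiv.toLinearMap w) 1 ^ 2 +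
        1 ^ 2 * (R.toLinearEquiv.toLinearMap w) 2 ^ 2 = w 0 ^ 2 + w 1 ^ 2 + 1 ^ 2 * w 2 ^ 2 := by
    intro w
    simp only [one_pow, one_mul]
    change (R w) 0 ^ 2 + (R w) 1 ^ 2 + (R w) 2 ^ 2 = w 0 ^ 2 + w 1 ^ 2 + w 2 ^ 2
    rw [hnormsq, hnormsq, LinearIsometryEquiv.norm_map]
  exact hiso n R.toLinearEquiv.toLinearMap hR z

/-! ### The milestone inside route ModularBoosts -/

/-- **Inside route ModularBoosts the milestone hinges on the two cruxes alone**: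
`IsingLimitLightCone → ModularBoostIsotropy → LimitRotationInvariance`. Given the light cone (L)
and the modular engine (M), a normalised non-degenerate translation-invariant scale-covariant limit
`S` is invariant under the orthogonal group of `x₀² + x₁² + c² x₂²` for some `c > 0`; the axis swap
`x₀ ↔ x₂` passes to the limit for free (`limit_axisPerm`), `Δ ≥ 1/2 > 0` by the tree's window
(`window`), and (V) (`rotationInvariant_of_ellipsoid_swap`) concludes `c = 1` and `O(3)`.
[cite: DuminilCopinICM2022, §8.1] -/
theorem limitRotationInvariance_of_lightCone_of_modular (hL : IsingLimitLightCone)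
    (hM : ModularBoostIsotropy) : LimitRotationInvariance := by
  intro ρ Δ S hρ hlim hnorm hnd htr hsc
  obtain ⟨v, hv, ha, hb⟩ := hL ρ Δ S hρ hlim hnorm hnd htr hsc
  obtain ⟨c, hc, hiso⟩ := hM ρ Δ v S hρ hlim hnorm hnd htr hsc hv ha hb
  have hΔ : 0 < Δ := lt_of_lt_of_le one_half_pos (window hρ hlim hnd hsc).1
  exact rotationInvariant_of_ellipsoid_swap hΔ hc hnd hsc
    (fun n x => limit_axisPerm hlim hnorm _ n x) hiso

/-- The same reduction with the route's own support items as hypotheses (the logic of the route's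
assembly): (L), (M), (V) `EllipsoidToSphere`, (B₃) `IsingLimitAxisPermutation` give the milestone,
`Δ > 0` being supplied by the window `1/2 ≤ Δ ≤ 1`. [cite: DuminilCopinICM2022, §8.1] -/
theorem limitRotationInvariance_of_cruxes (hL : IsingLimitLightCone) (hM : ModularBoostIsotropy)
    (hV : EllipsoidToSphere) (hB : IsingLimitAxisPermutation) : LimitRotationInvariance := by
  intro ρ Δ S hρ hlim hnorm hnd htr hsc
  obtain ⟨v, hv, ha, hb⟩ := hL ρ Δ S hρ hlim hnorm hnd htr hsc
  obtain ⟨c, hc, hiso⟩ := hM ρ Δ v S hρ hlim hnorm hnd htr hsc hv ha hb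
  have hΔ : 0 < Δ := lt_of_lt_of_le one_half_pos (window hρ hlim hnd hsc).1
  exact hV Δ c S hΔ hc hnd hsc (hB ρ S hρ hlim hnorm (Equiv.swap (0 : Fin 3) 2)) hiso

/-- Conversely to nothing: the milestone also follows at once from the HyperoctahedralRP crux
(item stmt-1980), by `limitRotationInvariance_iff_hyperoctahedral`. [cite: DuminilCopinICM2022, §8.1] -/
theorem limitRotationInvariance_of_hyperoctahedral (h : HyperoctahedralRP.LimitRotationInvariant) :
    LimitRotationInvariance :=
  limitRotationInvariance_iff_hyperoctahedral.2 h

/-! ### Unconditionally: `O(3)` invariance at the levels `n ≤ 2` -/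

/-- **Levels `n ≤ 2` are settled.** Every normalised, non-degenerate, translation-invariant,
scale-covariant pointwise scaling limit `S` of `criticalCorr 3` satisfies
`S n (R x₁, …, R xₙ) = S n (x₁, …, xₙ)` for every linear isometry `R` and every configuration,
whenever `n ≤ 2`: for `n = 2` this is the tree's two-point isotropy (`kernel_rotation_invariant`:
nine-mirror rigidity `HRP2Rigidity_of` applied to the kernel `x ↦ S 2 (0, x)`) transported by
translation invariance, and both sides vanish on the diagonal; for `n = 1` it is translation
invariance; `n = 0` is empty. Hence `LimitRotationInvariance` can only fail at a level `n ≥ 3`.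
[cite: DuminilCopinICM2022, §8.1] -/
theorem rotation_invariant_of_le_two (hρ : ∀ δ ∈ Set.Ioc (0:ℝ) 1, 0 < ρ δ)
    (hlim : HasPointwiseScalingLimit (criticalCorr 3) ρ S)
    (hnorm : ∀ n z, z ∉ NonCoincident 3 n → S n z = 0) (hnd : IsNondegenerateTwoPoint S)
    (htr : IsTranslationInvariant S) (hsc : IsScaleCovariant Δ S) {n : ℕ} (hn : n ≤ 2)
    (R : EuclideanSpace ℝ (Fin 3) ≃ₗᵢ[ℝ] EuclideanSpace ℝ (Fin 3))
    (x : Fin n → EuclideanSpace ℝ (Fin 3)) : S n (fun i => R (x i)) = S n x := by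
  interval_cases n
  · -- `n = 0`: the configuration is empty
    have : (fun i => R (x i)) = x := funext fun i => Fin.elim0 i
    rw [this]
  · -- `n = 1`: a translate
    have hcfg : (fun i => R (x i)) = fun i => x i + (R (x 0) - x 0) := by
      funext i
      fin_cases i
      simp
    rw [hcfg, htr 1 (R (x 0) - x 0) x]
  · -- `n = 2`
    by_cases hx : x ∈ NonCoincident 3 2
    · have hne : x 0 ≠ x 1 := fun h => by
        have := (mem_nonCoincident x).1 hx h
        exact absurd this (by decide)
      have hRne : R (x 0) ≠ R (x 1) := fun h => hne (R.injective h)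
      have hx2 : x = ![x 0, x 1] := by funext i; fin_cases i <;> rfl
      have hRx2 : (fun i => R (x i)) = ![R (x 0), R (x 1)] := by funext i; fin_cases i <;> rfl
      have h2 : S 2 ![R (x 0), R (x 1)] = S 2 ![x 0, x 1] := by
        rw [limit_two_eq_of_sub hlim hRne, ← map_sub,
          kernel_rotation_invariant hρ hlim hnd htr hsc R (x 1 - x 0), ← limit_two_eq_of_sub hlim hne]
      rw [hRx2, h2, ← hx2]
    · rw [hnorm 2 x hx, hnorm 2 _ (mt (map_mem_nonCoincident_iff R x).1 hx)]

/-- **Odd levels are settled too.** Every normalised pointwise scaling limit `S` of `criticalCorr 3`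
vanishes identically at every odd level `n` — the odd critical correlators are `0` because
`m*(β_c) = 0` on `ℤ³` (Aizenman–Duminil-Copin–Sidoravicius 2015; tree theorem
`HasPointwiseScalingLimit.eq_zero_of_odd`) — so it is trivially `O(3)`-invariant there.
[cite: AizenmanDuminilCopinSidoraviciusCMP2015, Thm. 1.2] -/
theorem rotation_invariant_of_odd (hlim : HasPointwiseScalingLimit (criticalCorr 3) ρ S)
    (hnorm : ∀ n z, z ∉ NonCoincident 3 n → S n z = 0) {n : ℕ} (hn : Odd n)
    (R : EuclideanSpace ℝ (Fin 3) ≃ₗᵢ[ℝ] EuclideanSpace ℝ (Fin 3))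
    (x : Fin n → EuclideanSpace ℝ (Fin 3)) : S n (fun i => R (x i)) = S n x := by
  have h0 : ∀ z : Fin n → EuclideanSpace ℝ (Fin 3), S n z = 0 := fun z => by
    by_cases hz : z ∈ NonCoincident 3 n
    · exact hlim.eq_zero_of_odd le_rfl hn hz
    · exact hnorm n z hz
  rw [h0, h0]

/-- **What is left of the milestone is exactly the even levels `n ≥ 4` on non-coincident
configurations**: `LimitRotationInvariance` is equivalent to `O(3)` invariance of every normalised,
non-degenerate, translation-invariant, scale-covariant pointwise limit of `criticalCorr 3` at the
even levels `n ≥ 4` and at non-coincident configurations only (levels `n ≤ 2` by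
`rotation_invariant_of_le_two`, odd levels by `rotation_invariant_of_odd`, coincident
configurations by the normalisation). [cite: DuminilCopinICM2022, §8.1] -/
theorem limitRotationInvariance_iff_even_four_le :
    LimitRotationInvariance ↔
      ∀ (ρ : ℝ → ℝ) (Δ : ℝ) (S : CorrFamily 3), (∀ δ ∈ Set.Ioc (0:ℝ) 1, 0 < ρ δ) →
        HasPointwiseScalingLimit (criticalCorr 3) ρ S →
        (∀ n z, z ∉ NonCoincident 3 n → S n z = 0) → IsNondegenerateTwoPoint S →
        IsTranslationInvariant S → IsScaleCovariant Δ S →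
        ∀ n : ℕ, Even n → 4 ≤ n →
          ∀ (R : EuclideanSpace ℝ (Fin 3) ≃ₗᵢ[ℝ] EuclideanSpace ℝ (Fin 3))
            (x : Fin n → EuclideanSpace ℝ (Fin 3)), x ∈ NonCoincident 3 n →
            S n (fun i => R (x i)) = S n x := by
  constructor
  · intro h ρ Δ S hρ hlim hnorm hnd htr hsc n _ _ R x _
    exact h ρ Δ S hρ hlim hnorm hnd htr hsc n R x
  · intro h ρ Δ S hρ hlim hnorm hnd htr hsc n R x
    rcases Nat.even_or_odd n with hev | hodd
    · by_cases hn : n ≤ 2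
      · exact rotation_invariant_of_le_two hρ hlim hnorm hnd htr hsc hn R x
      · by_cases hx : x ∈ NonCoincident 3 n
        · have h4 : 4 ≤ n := by
            obtain ⟨k, rfl⟩ := hev
            omega
          exact h ρ Δ S hρ hlim hnorm hnd htr hsc n hev h4 R x hx
        · rw [hnorm n x hx, hnorm n _ (mt (map_mem_nonCoincident_iff R x).1 hx)]
    · exact rotation_invariant_of_odd hlim hnorm hodd R x

/-- Hence the milestone follows from `O(3)` invariance at the even levels `n ≥ 4` on non-coincident
configurations alone. [cite: DuminilCopinICM2022, §8.1] -/
theorem limitRotationInvariance_of_even_four_le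
    (h : ∀ (ρ : ℝ → ℝ) (Δ : ℝ) (S : CorrFamily 3), (∀ δ ∈ Set.Ioc (0:ℝ) 1, 0 < ρ δ) →
        HasPointwiseScalingLimit (criticalCorr 3) ρ S →
        (∀ n z, z ∉ NonCoincident 3 n → S n z = 0) → IsNondegenerateTwoPoint S →
        IsTranslationInvariant S → IsScaleCovariant Δ S →
        ∀ n : ℕ, Even n → 4 ≤ n →
          ∀ (R : EuclideanSpace ℝ (Fin 3) ≃ₗᵢ[ℝ] EuclideanSpace ℝ (Fin 3))
            (x : Fin n → EuclideanSpace ℝ (Fin 3)), x ∈ NonCoincident 3 n →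
            S n (fun i => R (x i)) = S n x) :
    LimitRotationInvariance :=
  limitRotationInvariance_iff_even_four_le.2 h

end Summit.CriticalPhenomena.Ising3DConformalLimit.ModularBoostsRotation

end
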